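import Literature.Probability.Percolation.CutClustersLattice
import Literature.Probability.Percolation.SandwichModifications
import Literature.Probability.Percolation.NoThreeBranches
import HarnessLib

/-!
# Uniqueness of the infinite cluster under "sandwich" insertion tolerance

Topic `Literature/Probability/Percolation`; theorems only. The Burton–Keane / Newman–Schulman
uniqueness argument in the cut-ball form of Bollobás–Riordan, *Percolation* (2006), Ch. 5, Lemma 2
and Thm. 4 (tree: `UniquenessInfiniteCluster.lean` for `P_p`, `UniquenessInsertionTolerant.lean`
for insertion-tolerant ergodic laws), run for a probability measure `μ` on bond configurations of
`ℤ^d` which is carried by lattice configurations, translation invariant, ergodic under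
translations, and satisfies only the following **sandwich insertion tolerance**: for every `N`
there is `N' ≥ N` such that every `μ`-null event `S` is still avoided, `μ`-almost surely, by
*some* modification `η ∪ D` of the configuration with `E(Λ_N) ⊆ D ⊆ E(Λ_{N'})` — opening all
edges of `Λ_N` is allowed to open, in an uncontrolled way, further edges of `Λ_{N'}`
(`ae_numInfiniteClusters_le_one_of_sandwich`). Genuine insertion tolerance is the case `N' = N`.
The hypothesis is what a **monotone finite-range factor** of Bernoulli percolation inherits from
the insertion tolerance of its labels (opening all labels of `Λ_{N+R+1}` opens every output edge
of `Λ_N` and changes no output edge outside `Λ_{N+2R+2}`); the output law itself need not be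
insertion tolerant.

The proof (Bollobás–Riordan 2006, Ch. 5, pp. 105–109, with two changes):

* `μ(`exactly two infinite clusters`) = 0` (`measure_exactlyTwoInfClusters_eq_zero_of_sandwich`):
  on `T_{n,2}` every sandwich modification `η ∪ D`, `E(Λ_n) ⊆ D`, has exactly one infinite
  cluster (`mem_exactlyOneInfCluster_of_sandwich`, `SandwichModifications.lean`: a finite
  modification creates no infinite cluster and `Λ_n` is open), so `μ(I₁) > 0`; ergodicity.
* `μ(`at least three infinite clusters`) = 0` (`measure_threeInfClusters_eq_zero_of_sandwich`):
  the cut-balls are replaced by the **cut clusters** of `CutClusters.lean` (hub = open cluster of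
  the centre inside `Λ_{N''}`). If `Λ_r` meets three infinite clusters with positive probability,
  LOCALISE: for some `M`, with positive probability every open connection between a site of
  `Λ_{N'}` and a site of `Λ_r` is realised inside `Λ_M`. Then for every sandwich modification
  `ζ = η ∪ D` the hub of `ζ` in `Λ_{N''}`, `N'' = M + N'`, contains every vertex of `Λ_{N'}` joined
  to one of the three clusters, so an open path of `ζ` avoiding the hub uses no new edge; the
  three clusters therefore leave `Λ_{N''}` through three exits lying in distinct infinite clusters
  of `ζ -` hub (`exists_exit_of_percolatesAt`, `mem_cutClusterAt_of_three`,
  `SandwichModifications.lean`): `ζ` is a cut cluster.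
  Hence the cut-cluster event has probability `a > 0`, and the counting of
  `CutClustersLattice.lean` (`≥ a(2m+1)^d` expected cut clusters among disjoint translates, but
  deterministically `≤ |∂ⁱⁿΛ| = O((2m+1)^{d-1})`) gives the contradiction.

## References

* B. Bollobás, O. Riordan, *Percolation*, CUP 2006, Ch. 5, Lemma 2 and Thm. 4, pp. 105–109 of the
  held copy. [BollobasRiordan2006]
* R. M. Burton, M. Keane, *Density and uniqueness in percolation*, Comm. Math. Phys. 121 (1989)
  501–505. [BurtonKeane1989]

## Mathlib status

No percolation in Mathlib. Anchors: `MeasureTheory.measure_iUnion_null_iff`,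
`MeasureTheory.measure_inter_conull`, `Finset.sup`; tree: `hubIn`, `cutClusterAt`,
`measurableSet_cutClusterAt`, `sum_measure_cutClusterAt_le_of_ae_subset`,
`real_cutClusterAt_zero_le_of_invariant`, `mem_cutClusterAt_of_three`,
`mem_exactlyOneInfCluster_of_sandwich`, `threeInBox`, `twoInBox`, `openEdges`,
`exists_finset_subset_box`.
-/

noncomputable section

namespace Literature.Probability.Percolation

open MeasureTheory ProbabilityTheory SimpleGraph Finset
open Percolation (shiftedBox mem_shiftedBox_iff shiftedBox_zero)
open scoped ENNReal

/-! ### Localisation of finitely many open connections inside a box -/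

section Lattice

variable {d : ℕ}

/-- **Localisation.** For finite sets `Z, C` of sites and any configuration `η` there is a box
`Λ_M` inside which every open connection of `η` between a site of `Z` and a site of `C` is
realised (finitely many pairs, each joined by a finite open path). [folklore] -/
theorem exists_box_reachable_within (Z C : Finset (LatticeModels.Site d)) (η : BondConfig (LatticeModels.Site d)) :
    ∃ M : ℕ, ∀ p ∈ Z, ∀ q ∈ C, (openGraph η).Reachable p q →
      (withinGraph (openGraph η) ↑(LatticeModels.box d M)).Reachable p q := by
  classical
  -- a box for each pair
  have hpair : ∀ pq : LatticeModels.Site d × LatticeModels.Site d, ∃ M : ℕ, (openGraph η).Reachable pq.1 pq.2 →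
      (withinGraph (openGraph η) ↑(LatticeModels.box d M)).Reachable pq.1 pq.2 := by
    rintro ⟨p, q⟩
    by_cases h : (openGraph η).Reachable p q
    · obtain ⟨π⟩ := h
      obtain ⟨M, hM⟩ := exists_finset_subset_box (d := d) π.support.toFinset
      refine ⟨M, fun _ => reachable_withinGraph_of_support_subset _ π fun v hv => ?_⟩
      exact hM (List.mem_toFinset.2 hv)
    · exact ⟨0, fun h' => absurd h' h⟩
  choose M hM using hpair
  refine ⟨(Z ×ˢ C).sup M, fun p hp q hq hpq => ?_⟩
  have hle : M (p, q) ≤ (Z ×ˢ C).sup M := Finset.le_sup (f := M) (Finset.mem_product.2 ⟨hp, hq⟩)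
  exact (hM (p, q) hpq).mono (withinGraph_mono _ (Finset.coe_subset.2 (LatticeModels.box_mono d hle)))

/-! ### No three infinite clusters (Bollobás–Riordan 2006, Ch. 5, Thm. 4, with cut clusters) -/

/-- **`μ(`at least three infinite clusters`) = 0` under sandwich insertion tolerance**, for a
probability measure on bond configurations of `ℤ^d`, `d ≥ 1`, carried by lattice configurations
and translation invariant (Bollobás–Riordan 2006, Ch. 5, Thm. 4, pp. 107–109, with cut clusters in
place of cut-balls; see the module docstring for the localisation step). [cite: BollobasRiordan2006, Ch. 5, Thm. 4 (pp. 107–109)] -/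
theorem measure_threeInfClusters_eq_zero_of_sandwich (hd : 1 ≤ d)
    (μ : Measure (BondConfig (LatticeModels.Site d))) [IsProbabilityMeasure μ]
    (hS : ∀ᵐ ω ∂μ, ω ⊆ (LatticeModels.zdGraph d).edgeSet)
    (hT : ∀ v : LatticeModels.Site d, MeasurePreserving (BondConfig.relabel (sym2Equiv (LatticeModels.Site.shift v))) μ μ)
    (hI : ∀ N : ℕ, ∃ N' : ℕ, N ≤ N' ∧ ∀ S : Set (BondConfig (LatticeModels.Site d)), MeasurableSet S → μ S = 0 →
      μ {η | ∀ D : Finset (Sym2 (LatticeModels.Site d)), LatticeModels.edgesIn (LatticeModels.zdGraph d) (LatticeModels.box d N) ⊆ D →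
        D ⊆ LatticeModels.edgesIn (LatticeModels.zdGraph d) (LatticeModels.box d N') → openEdges ↑D η ∈ S} = 0) :
    μ (threeInfClusters (LatticeModels.Site d)) = 0 := by
  classical
  by_contra h3
  -- some box meets three infinite clusters with positive probability
  obtain ⟨r, hr⟩ : ∃ r, μ (threeInBox (d := d) r) ≠ 0 := by
    by_contra hall
    push Not at hall
    exact h3 (measure_mono_null threeInfClusters_subset_iUnion (measure_iUnion_null_iff.2 hall))
  obtain ⟨N', hrN', hI'⟩ := hI r
  -- localisation of the connections between `Λ_{N'}` and `Λ_r`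
  set Loc : ℕ → Set (BondConfig (LatticeModels.Site d)) := fun M =>
    {η | ∀ p ∈ LatticeModels.box d N', ∀ q ∈ LatticeModels.box d r, (openGraph η).Reachable p q →
      (withinGraph (openGraph η) ↑(LatticeModels.box d M)).Reachable p q} with hLoc
  obtain ⟨M, hM⟩ : ∃ M, μ (threeInBox (d := d) r ∩ Loc M) ≠ 0 := by
    by_contra hall
    push Not at hall
    apply hr
    have hcov : threeInBox (d := d) r ⊆ ⋃ M, (threeInBox r ∩ Loc M) := fun η hη => by
      obtain ⟨M, hM⟩ := exists_box_reachable_within (LatticeModels.box d N') (LatticeModels.box d r) η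
      exact Set.mem_iUnion.2 ⟨M, hη, hM⟩
    exact measure_mono_null hcov (measure_iUnion_null_iff.2 hall)
  set N'' := M + N' with hN''
  set A : Set (BondConfig (LatticeModels.Site d)) := (threeInBox r ∩ Loc M) ∩ {ω | ω ⊆ (LatticeModels.zdGraph d).edgeSet} with hA_def
  have hAE : μ {ω : BondConfig (LatticeModels.Site d) | ω ⊆ (LatticeModels.zdGraph d).edgeSet}ᶜ = 0 := by
    rw [Set.compl_setOf]
    exact ae_iff.1 hS
  have hA : μ A ≠ 0 := by rwa [hA_def, measure_inter_conull hAE]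
  -- the cut-cluster event at the origin in `Λ_{N''}`
  set T : Set (BondConfig (LatticeModels.Site d)) := cutClusterAt (shiftedBox (0 : LatticeModels.Site d) N'') 0 with hT_def
  have hTm : MeasurableSet T := measurableSet_cutClusterAt _ _
  have hboxes : LatticeModels.box d r ⊆ shiftedBox (0 : LatticeModels.Site d) N'' := by
    rw [shiftedBox_zero]; exact LatticeModels.box_mono d (by omega)
  have hboxes' : LatticeModels.box d N' ⊆ shiftedBox (0 : LatticeModels.Site d) N'' := by
    rw [shiftedBox_zero]; exact LatticeModels.box_mono d (by omega)
  have hAT : A ⊆ {η | ∀ D : Finset (Sym2 (LatticeModels.Site d)),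
      LatticeModels.edgesIn (LatticeModels.zdGraph d) (LatticeModels.box d r) ⊆ D →
      D ⊆ LatticeModels.edgesIn (LatticeModels.zdGraph d) (LatticeModels.box d N') → openEdges ↑D η ∈ T} := by
    rintro η ⟨⟨⟨x, hxbox, hperc, hdis⟩, hloc⟩, hηG⟩ D hD1 hD2
    set ζ := openEdges (↑D : Set (Sym2 (LatticeModels.Site d))) η with hζ
    have hηζ : η ⊆ ζ := subset_openEdges _ η
    have hnew : ∀ e ∈ ζ, e ∉ η → ∀ a ∈ e, a ∈ LatticeModels.box d N' := by
      intro e he heη a ha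
      rcases he with he | he
      · exact absurd he heη
      · exact (LatticeModels.mem_edgesIn_iff.1 (hD2 he)).2 a ha
    -- the three vertices lie in the hub (all edges of `Λ_r` are open in `ζ`)
    have hrζ : (↑(LatticeModels.edgesIn (LatticeModels.zdGraph d) (LatticeModels.box d r)) : Set (Sym2 (LatticeModels.Site d))) ⊆ ζ :=
      fun e he => Or.inr (hD1 he)
    have hxK : ∀ i, x i ∈ hubIn ζ (shiftedBox (0 : LatticeModels.Site d) N'') 0 := fun i => by
      refine mem_hubIn_iff.2 ⟨hboxes (hxbox i), ?_⟩
      exact (reachable_of_edgesIn_subset (fun a ha b hb => box_withinGraph_reachable r ha hb) hrζ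
        (LatticeModels.zero_mem_box d r) (hxbox i)).mono (withinGraph_mono _ (Finset.coe_subset.2 hboxes))
    refine mem_cutClusterAt_of_three hηζ hηG hnew hxK hperc hdis fun p hp i hip => ?_
    have h1 := hloc p hp (x i) (hxbox i) hip.symm
    have h2 : (withinGraph (openGraph ζ) ↑(shiftedBox (0 : LatticeModels.Site d) N'')).Reachable p (x i) :=
      h1.mono ((withinGraph_mono_left (fromEdgeSet_mono hηζ) _).trans
        (withinGraph_mono _ (by rw [shiftedBox_zero]; exact Finset.coe_subset.2 (LatticeModels.box_mono d (by omega)))))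
    exact mem_hubIn_of_reachable (hxK i) h2.symm (hboxes' hp)
  have hT0 : μ T ≠ 0 := fun h0 => hA (measure_mono_null hAT (hI' T hTm h0))
  have ha : 0 < μ.real T := by
    rw [measureReal_def, ENNReal.toReal_pos_iff]
    exact ⟨pos_iff_ne_zero.2 hT0, measure_lt_top _ _⟩
  set a := μ.real T with ha_def
  -- choose the number of translates
  set C₀ : ℕ := 2 * d * (2 * N'' + 3) ^ (d - 1) with hC₀
  obtain ⟨m, hm⟩ := exists_nat_gt ((C₀ : ℝ) / a)
  have hm' : (C₀ : ℝ) < a * (2 * m + 1) := by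
    rw [div_lt_iff₀ ha] at hm
    nlinarith
  set n := (2 * N'' + 2) * m + N'' with hn
  set L := LatticeModels.innerBoundary (LatticeModels.zdGraph d) (LatticeModels.box d (n + 1)) with hL
  -- lower bound for the expected number of cut clusters
  have hlow : ((2 * m + 1 : ℝ)) ^ d * a ≤ ∑ c ∈ centres N'' m, μ.real (cutClusterAt (shiftedBox c N'') c) := by
    calc ((2 * m + 1 : ℝ)) ^ d * a = ∑ _c ∈ centres (d := d) N'' m, a := by
          rw [Finset.sum_const, card_centres, nsmul_eq_mul]; push_cast; ring
      _ ≤ ∑ c ∈ centres N'' m, μ.real (cutClusterAt (shiftedBox c N'') c) :=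
          Finset.sum_le_sum fun c _ => real_cutClusterAt_zero_le_of_invariant μ hT c N''
  -- upper bound
  have hup : ∑ c ∈ centres N'' m, μ.real (cutClusterAt (shiftedBox c N'') c) ≤ (L.card : ℝ) := by
    have h' := sum_measure_cutClusterAt_le_of_ae_subset μ hS N'' m
    have hsum : ∑ c ∈ centres N'' m, μ.real (cutClusterAt (shiftedBox c N'') c) =
        (∑ c ∈ centres N'' m, μ (cutClusterAt (shiftedBox c N'') c)).toReal := by
      rw [ENNReal.toReal_sum fun c _ => measure_ne_top _ _]
      rfl
    rw [hsum]
    have := ENNReal.toReal_mono (ENNReal.natCast_ne_top L.card) h'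
    simpa using this
  -- the boundary is small
  have hLcard : (L.card : ℝ) ≤ C₀ * (2 * m + 1 : ℝ) ^ (d - 1) := by
    have h1 := card_innerBoundary_box_le (d := d) (n + 1)
    have h2 : 2 * (n + 1) + 1 ≤ (2 * N'' + 3) * (2 * m + 1) := by
      have : (2 * N'' + 3) * (2 * m + 1) = 2 * (n + 1) + 1 + 2 * m := by rw [hn]; ring
      omega
    calc (L.card : ℝ) ≤ ((2 * d * (2 * (n + 1) + 1) ^ (d - 1) : ℕ) : ℝ) := by exact_mod_cast h1
      _ ≤ ((2 * d * ((2 * N'' + 3) * (2 * m + 1)) ^ (d - 1) : ℕ) : ℝ) := by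
          exact_mod_cast Nat.mul_le_mul_left _ (Nat.pow_le_pow_left h2 _)
      _ = C₀ * (2 * m + 1 : ℝ) ^ (d - 1) := by rw [hC₀]; push_cast; rw [mul_pow]; ring
  -- combine
  have hpow : (2 * m + 1 : ℝ) ^ d = (2 * m + 1) * (2 * m + 1) ^ (d - 1) := by
    conv_lhs => rw [← Nat.sub_add_cancel hd, pow_succ]
    ring
  have hchain := hlow.trans (hup.trans hLcard)
  rw [hpow] at hchain
  have hpos : (0 : ℝ) < (2 * m + 1) ^ (d - 1) := by positivity
  have key : (2 * m + 1 : ℝ) * a ≤ C₀ := by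
    have h' : ((2 * m + 1 : ℝ) * a) * (2 * m + 1) ^ (d - 1) ≤ (C₀ : ℝ) * (2 * m + 1) ^ (d - 1) := by
      linarith [hchain]
    exact le_of_mul_le_mul_right h' hpos
  linarith [key, hm']

/-! ### No two infinite clusters (Bollobás–Riordan 2006, Ch. 5, Lemma 2) -/

/-- **`μ(`exactly two infinite clusters`) = 0` under sandwich insertion tolerance and
ergodicity** (Bollobás–Riordan 2006, Ch. 5, Lemma 2, pp. 105–106; Newman–Schulman): on `T_{n,2}`
every sandwich modification has exactly one infinite cluster (`mem_exactlyOneInfCluster_of_sandwich`),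
so `μ(I₁) > 0`; `I₁`, `I₂` are invariant under translations, hence both would have probability
`1`. [cite: BollobasRiordan2006, Ch. 5, Lemma 2 (pp. 105–106)] -/
theorem measure_exactlyTwoInfClusters_eq_zero_of_sandwich
    (μ : Measure (BondConfig (LatticeModels.Site d))) [IsProbabilityMeasure μ]
    (hS : ∀ᵐ ω ∂μ, ω ⊆ (LatticeModels.zdGraph d).edgeSet)
    (hE : ∀ S : Set (BondConfig (LatticeModels.Site d)), MeasurableSet S →
      (∀ v : LatticeModels.Site d, BondConfig.relabel (sym2Equiv (LatticeModels.Site.shift v)) ⁻¹' S = S) → μ S = 0 ∨ μ S = 1)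
    (hI : ∀ N : ℕ, ∃ N' : ℕ, N ≤ N' ∧ ∀ S : Set (BondConfig (LatticeModels.Site d)), MeasurableSet S → μ S = 0 →
      μ {η | ∀ D : Finset (Sym2 (LatticeModels.Site d)), LatticeModels.edgesIn (LatticeModels.zdGraph d) (LatticeModels.box d N) ⊆ D →
        D ⊆ LatticeModels.edgesIn (LatticeModels.zdGraph d) (LatticeModels.box d N') → openEdges ↑D η ∈ S} = 0) :
    μ (exactlyTwoInfClusters (LatticeModels.Site d)) = 0 := by
  classical
  by_contra h2
  -- some `T_{n,2}` has positive probability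
  obtain ⟨n, hn⟩ : ∃ n, μ (twoInBox (d := d) n) ≠ 0 := by
    by_contra hall
    push Not at hall
    exact h2 (measure_mono_null exactlyTwoInfClusters_subset_iUnion (measure_iUnion_null_iff.2 hall))
  obtain ⟨N', -, hI'⟩ := hI n
  set A : Set (BondConfig (LatticeModels.Site d)) := twoInBox n ∩ {ω | ω ⊆ (LatticeModels.zdGraph d).edgeSet} with hA_def
  have hAE : μ {ω : BondConfig (LatticeModels.Site d) | ω ⊆ (LatticeModels.zdGraph d).edgeSet}ᶜ = 0 := by
    rw [Set.compl_setOf]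
    exact ae_iff.1 hS
  have hA : μ A ≠ 0 := by rwa [hA_def, measure_inter_conull hAE]
  -- every sandwich modification merges the two clusters
  have hAT : A ⊆ {η | ∀ D : Finset (Sym2 (LatticeModels.Site d)),
      LatticeModels.edgesIn (LatticeModels.zdGraph d) (LatticeModels.box d n) ⊆ D →
      D ⊆ LatticeModels.edgesIn (LatticeModels.zdGraph d) (LatticeModels.box d N') →
      openEdges ↑D η ∈ exactlyOneInfCluster (LatticeModels.Site d)} := by
    rintro η ⟨⟨x, y, hx, hy, hpx, -, -, hall⟩, -⟩ D hD1 hD2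
    refine mem_exactlyOneInfCluster_of_sandwich (fun a ha b hb => box_withinGraph_reachable n ha hb)
      (LatticeModels.box d N') (subset_openEdges _ η) (fun e he => Or.inr (hD1 he)) (fun e he heη a ha => ?_) hx hy hpx hall
    rcases he with he | he
    · exact absurd he heη
    · exact (LatticeModels.mem_edgesIn_iff.1 (hD2 he)).2 a ha
  have h1 : μ (exactlyOneInfCluster (LatticeModels.Site d)) ≠ 0 := fun h0 =>
    hA (measure_mono_null hAT (hI' _ measurableSet_exactlyOneInfCluster h0))
  -- ergodicity
  have hI1 : μ (exactlyOneInfCluster (LatticeModels.Site d)) = 1 := by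
    rcases hE _ measurableSet_exactlyOneInfCluster
      (fun v => preimage_relabel_exactlyOneInfCluster (LatticeModels.Site.shift v)) with h' | h'
    · exact absurd h' h1
    · exact h'
  have hI2 : μ (exactlyTwoInfClusters (LatticeModels.Site d)) = 1 := by
    rcases hE _ measurableSet_exactlyTwoInfClusters
      (fun v => preimage_relabel_exactlyTwoInfClusters (LatticeModels.Site.shift v)) with h' | h'
    · exact absurd h' h2
    · exact h'
  have hunion : μ (exactlyOneInfCluster (LatticeModels.Site d) ∪ exactlyTwoInfClusters (LatticeModels.Site d)) = 2 := by
    rw [measure_union disjoint_exactlyOne_exactlyTwo measurableSet_exactlyTwoInfClusters, hI1, hI2,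
      one_add_one_eq_two]
  have hle := prob_le_one (μ := μ) (s := exactlyOneInfCluster (LatticeModels.Site d) ∪ exactlyTwoInfClusters (LatticeModels.Site d))
  rw [hunion] at hle
  exact absurd hle (not_le.2 ENNReal.one_lt_two)

/-! ### Uniqueness of the infinite cluster -/

/-- **Uniqueness of the infinite cluster under sandwich insertion tolerance** (Burton–Keane 1989;
Bollobás–Riordan 2006, Ch. 5, Lemma 2 + Thm. 4, for laws whose only tolerance is the sandwich
form of the module docstring): for every probability measure `μ` on bond configurations of `ℤ^d`
which is carried by lattice configurations, translation invariant, ergodic under translations and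
sandwich insertion tolerant, `μ`-almost surely there is at most one infinite open cluster.
[cite: BollobasRiordan2006, Ch. 5, Lemma 2 and Thm. 4 (pp. 105–109)] -/
theorem ae_numInfiniteClusters_le_one_of_sandwich
    (μ : Measure (BondConfig (LatticeModels.Site d))) [IsProbabilityMeasure μ]
    (hS : ∀ᵐ ω ∂μ, ω ⊆ (LatticeModels.zdGraph d).edgeSet)
    (hT : ∀ v : LatticeModels.Site d, MeasurePreserving (BondConfig.relabel (sym2Equiv (LatticeModels.Site.shift v))) μ μ)
    (hE : ∀ S : Set (BondConfig (LatticeModels.Site d)), MeasurableSet S →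
      (∀ v : LatticeModels.Site d, BondConfig.relabel (sym2Equiv (LatticeModels.Site.shift v)) ⁻¹' S = S) → μ S = 0 ∨ μ S = 1)
    (hI : ∀ N : ℕ, ∃ N' : ℕ, N ≤ N' ∧ ∀ S : Set (BondConfig (LatticeModels.Site d)), MeasurableSet S → μ S = 0 →
      μ {η | ∀ D : Finset (Sym2 (LatticeModels.Site d)), LatticeModels.edgesIn (LatticeModels.zdGraph d) (LatticeModels.box d N) ⊆ D →
        D ⊆ LatticeModels.edgesIn (LatticeModels.zdGraph d) (LatticeModels.box d N') → openEdges ↑D η ∈ S} = 0) :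
    ∀ᵐ ω ∂μ, numInfiniteClusters ω ≤ 1 := by
  rcases Nat.eq_zero_or_pos d with hd | hd
  · -- `d = 0`: `ℤ⁰` is a single site, no cluster is infinite
    subst hd
    refine Filter.Eventually.of_forall fun ω => ?_
    rw [numInfiniteClusters_le_one_iff]
    intro x y hx
    exact absurd hx (Set.not_infinite.2 (Set.toFinite _))
  · rw [ae_iff]
    refine measure_mono_null (fun ω hω => mem_union_of_not_numInfiniteClusters_le_one hω) ?_
    exact measure_union_null (measure_exactlyTwoInfClusters_eq_zero_of_sandwich μ hS hE hI)
      (measure_threeInfClusters_eq_zero_of_sandwich hd μ hS hT hI)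

end Lattice

end Literature.Probability.Percolation

end
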